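import Mathlib
import Summits.ResolutionOfSingularities.ResolutionOfSingularities.Theorems.WildQuotientsWildQuotientResolutionJordanFiveChart0Fixed
import Summits.ResolutionOfSingularities.ResolutionOfSingularities.Theorems.WildQuotientsWildQuotientResolutionQuarter1123WeightZero
import Summits.ResolutionOfSingularities.ResolutionOfSingularities.Theorems.WildQuotientsWildQuotientResolutionQuarter1123Defs
import Summits.ResolutionOfSingularities.ResolutionOfSingularities.Theorems.WildQuotientsWildQuotientResolutionToricChartFaceComap
import Summits.ResolutionOfSingularities.ResolutionOfSingularities.Theorems.WildQuotientsWildQuotientResolutionJordanFiveX0ChartTools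
import Summits.ResolutionOfSingularities.ResolutionOfSingularities.Theorems.WildQuotientsWildQuotientResolutionJordanFiveX0ChartSlots
import Summits.ResolutionOfSingularities.ResolutionOfSingularities.Theorems.WildQuotientsWildQuotientResolutionJordanFourChart0VertexIdeal

/-!
# RUNG V5 (`J₅`), brick `HP₀` ring side: the chart-`0` (`μ₄`-vertex) RING MODEL

(crux stmt-ResolutionOfSingularities-15640 `WildQuotients.WildQuotientResolution`, line `Sketch`;
chain w45c RUNG V5 scaffold `JordanFive.jordanFive_hasResolution_of_bricks` (p527978), brick `HP₀`
in the β‴ one-shot form (`L/w45c/HP0-ONESHOT-DESIGN.md` §3–§5, res-L1-w45c-plan-1 RULING v8.4-B and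
ORDERS 2026-08-27T12:39:07Z «stub-2: `JordanFive.exists_ringBrick_X0_model` = the X1-model's twin for
O₀ = chart 0»); the twin of `JordanFive.exists_ringBrick_X1_model` (p531492) and of V4U's
`JordanFour.brickH0` (p508076) one floor up. [OURS · L1 W4.5c] — NOT a statement of any manuscript;
replaces the role of no printed item. Prover res-L1-w45c-stub-2. Def-free.)

SETTING. `k[x]` doubles as the ROOT CHART `U₀ = k[ρ, y₁, y₂, y₃, y₄, passengers]` of the
`μ₄`-vertex chart `O₀ = V[x_a³]` of `V = Bl_{I₁₂} 𝔸ⁿ` (slots `ρ = X a, y₁ = X b, y₂ = X c, y₃ = X d,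
y₄ = X e`); the chart ring is any `C` with structure map `base : k[x] → C` and an identification
`eE : C ≃+* E` onto the weight-`0` part `E ⊆ k[x]` of the `μ₄`-weight `w₂ : (a,b,c,d) ↦ (1,1,2,3)` with
`eE (base F) = ψ₀ F` for the root substitution `ψ₀ : x_a ↦ ρ⁴, x_b ↦ ρ³y₁, x_c ↦ ρ²y₂, x_d ↦ ρy₃`
(res-L1-w45c-stub-5's seam `exists_sectionsEquiv_chart0` + (A1) `exists_ringEquiv_blowupChart0_weightZero`);
the lifted action is res-type-036's ABSTRACT root-chart law `σ_U` (`y₁ ↦ y₁ + ρ`, `y₂ ↦ y₂ + ρy₁`,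
`y₃ ↦ y₃ + ρy₂`, `y₄ ↦ y₄ + ρy₃`); the chart ratios are `t j` (`x_a³ · t_j = g_j`, `j ∉ {0,2,5,13}`:
the edge-surface equations) and `t' j` (`j ≠ 0`: the vertex-curve equations).

RESULT `exists_ringBrick_X0_model` (`p` prime `≥ 5 = char k`): there is an INJECTIVE ring map
`ψC : R₀ → C` from res-L1-w45c-stub-4's presented cone ring
`R₀ = ToricChart.Ring k P Quarter1123.quarterDatum` (`¼(1,1,2,3) × 𝔸^P`, `P` = passengers incl.
`x_e`, p527204) whose range is the `σ_U`-fixed subring (through `eE`), with the TWO RADICAL IDENTITIES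
`√(ψC⁻¹⟨base x_a, …, base x_d, t_j⟩) = faceIdeal {s,t,v}` (the singular axis `I_A·R₀` of the cone —
edge surface) and `√(ψC⁻¹⟨base x_•, t'_j⟩) = faceIdeal univ` (the vertex `𝔪_A·R₀` — `μ₄` vertex curve);
both radical (`Quarter1123.isRadical_faceIdeal_axis/univ`, p534460); the regularity input of the β‴ twin is
res-L1-w45c-stub-4's `Quarter1123.blowup_regular_mulColon` — NO regularity clause here.

ROUTE. `ψC := eE⁻¹ ∘ θ₅ ∘ rename(slot) ∘ θ` (`θ = ToricChart.theta`; `slot : (s,t,u,v) ↦ (x_a,x_b,x_c,x_d)`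
for `p ≡ 1 (mod 4)`, `↦ (x_b,x_d,x_c,x_a)` for `p ≡ 3`, as `(1,p̄,2,3) = 3·(3,1,2,1)`; `θ₅` = res-type-036's
slot substitution); range = fixed ring by `JordanFive.chart0_fixedPoints_eq_map` (p525294); radicals by
`JordanFour.radical_span_eq_comap_of_isIntegral` (`k[x]` integral over `E`; ratio values in
`⟨ρ, y₁, y₃⟩` / `⟨ρ, y₁, y₂, y₃⟩`; `y₁⁴ = q₁, y₃¹² = q₃, y₂⁶ = q₂`), then `θ₅⁻¹` (`comap_slotSubst5_span_X_*`),
`rename⁻¹` (`SpanX.comap_rename_span_X`), `θ⁻¹` (`ToricChart.comap_theta_span_X_eq_faceIdeal`).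
-/

-- single-problem summit: the doubled namespace component `ResolutionOfSingularities` is forced
set_option linter.dupNamespace false

noncomputable section

open MvPolynomial

namespace Summit.ResolutionOfSingularities.ResolutionOfSingularities.Theorems.WildQuotientResolution.JordanFive

variable (k : Type) [Field k] (n : ℕ) (a b c d e : Fin n) (p : ℕ)

/-- res-type-036's slot substitution datum (`Chart0Fixed`). -/
local notation3 "g₅" => (fun i : Fin n => if i = b then X b ^ p - X a ^ (p - 1) * X b
    else if i = c then 2 * X c - X b ^ 2 + X a * X b
    else if i = d then 3 * X d - 3 * (X b * X c) + X b ^ 3 - X a * X b ^ 2 + 2 * (X a * X c)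
    else if i = e then 4 * X e - 4 * (X b * X d) - 2 * X c ^ 2 + 4 * (X b ^ 2 * X c) - X b ^ 4
      + X a * X b ^ 3 - 3 * (X a * X b * X c) + 3 * (X a * X d)
    else (X i : MvPolynomial (Fin n) k))
/-- The root substitution `ψ₀` of the `μ₄`-vertex chart. -/
local notation3 "r₅" => (fun i : Fin n => if i = a then X a ^ 4 else if i = b then X a ^ 3 * X b
    else if i = c then X a ^ 2 * X c else if i = d then X a * X d else (X i : MvPolynomial (Fin n) k))
/-- The passenger index type. -/
local notation3 "Psg" => {i : Fin n // i ≠ a ∧ i ≠ b ∧ i ≠ c ∧ i ≠ d}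

variable (hab : a ≠ b) (hac : a ≠ c) (had : a ≠ d) (hae : a ≠ e) (hbc : b ≠ c) (hbd : b ≠ d)
  (hbe : b ≠ e) (hcd : c ≠ d) (hce : c ≠ e) (hde : d ≠ e)

include hab hac had hae hbc hbd hbe hcd hce hde in
-- one assembly over landed lemmas; the subalgebra coercions make some steps slow
set_option maxHeartbeats 1600000 in
/-- **The ring model, generic in the slot assignment** `(s,t,u,v) ↦ (a',b',c',d')` (a permutation of
`(a,b,c,d)` fixing `{a,b,d}` setwise and with cone weight `w'` equivalent to res-type-036's `w₁`).
[OURS · L1 W4.5c] -/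
theorem exists_ringBrick_X0_model_of_slots (a' b' c' d' : Fin n) (h'ab : a' ≠ b') (h'ac : a' ≠ c')
    (h'ad : a' ≠ d') (h'bc : b' ≠ c') (h'bd : b' ≠ d') (h'cd : c' ≠ d')
    (hS4 : ∀ i, (i = a' ∨ i = b' ∨ i = c' ∨ i = d') ↔ (i = a ∨ i = b ∨ i = c ∨ i = d))
    (hS3 : ∀ i, (i = a' ∨ i = b' ∨ i = d') ↔ (i = a ∨ i = b ∨ i = d))
    (w' : Fin n → ZMod 4) (h0 : w' a' = 1) (h1 : w' b' = 1) (h2 : w' c' = 2) (h3 : w' d' = 3)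
    (hw'0 : ∀ i, i ≠ a' → i ≠ b' → i ≠ c' → i ≠ d' → w' i = 0)
    (hp : p.Prime) (hp5 : 5 ≤ p) [CharP k p]
    (w₁ : Fin n → ZMod 4) (hw₁a : w₁ a = 1) (hw₁b : w₁ b = (p : ZMod 4)) (hw₁c : w₁ c = 2)
    (hw₁d : w₁ d = 3) (hw₁0 : ∀ i, i ≠ a → i ≠ b → i ≠ c → i ≠ d → w₁ i = 0)
    (hww : ∀ Q : MvPolynomial (Fin n) k, IsWeightedHomogeneous w₁ Q 0 ↔ IsWeightedHomogeneous w' Q 0)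
    (σU : MvPolynomial (Fin n) k ≃ₐ[k] MvPolynomial (Fin n) k)
    (hUb : σU (X b) = X b + X a) (hUc : σU (X c) = X c + X a * X b)
    (hUd : σU (X d) = X d + X a * X c) (hUe : σU (X e) = X e + X a * X d)
    (hσU : ∀ i, i ≠ b → i ≠ c → i ≠ d → i ≠ e → σU (X i) = X i)
    (w₂ : Fin n → ZMod 4) (hw₂a : w₂ a = 1) (hw₂b : w₂ b = 1) (hw₂c : w₂ c = 2) (hw₂d : w₂ d = 3)
    (hw₂0 : ∀ i, i ≠ a → i ≠ b → i ≠ c → i ≠ d → w₂ i = 0)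
    (E : Subalgebra k (MvPolynomial (Fin n) k)) (hE : ∀ f, f ∈ E ↔ IsWeightedHomogeneous w₂ f 0)
    {C : Type} [CommRing C] (base : MvPolynomial (Fin n) k →+* C) (eE : C ≃+* ↥E)
    (hbase : ∀ F, ((eE (base F) : ↥E) : MvPolynomial (Fin n) k) = aeval r₅ F)
    (t : {j : Fin 40 // j ≠ 0 ∧ j ≠ 2 ∧ j ≠ 5 ∧ j ≠ 13} → C)
    (ht : ∀ j, base (gens12 k n a b c d 0) * t j = base (gens12 k n a b c d j.1))
    (t' : {j : Fin 40 // j ≠ 0} → C)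
    (ht' : ∀ j, base (gens12 k n a b c d 0) * t' j = base (gens12 k n a b c d j.1)) :
    ∃ ψC : ToricChart.Ring k Psg Quarter1123.quarterDatum →+* C,
      Function.Injective ψC ∧
      (∀ y, y ∈ ψC.range ↔ σU ((eE y : ↥E) : MvPolynomial (Fin n) k) = (eE y : MvPolynomial (Fin n) k)) ∧
      ((Ideal.span (base '' {X a, X b, X c, X d} ∪ Set.range t)).comap ψC).radical =
        ToricChart.faceIdeal k Psg Quarter1123.quarterDatum {0, 1, 3} ∧
      ((Ideal.span (base '' {X a, X b, X c, X d} ∪ Set.range t')).comap ψC).radical =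
        ToricChart.faceIdeal k Psg Quarter1123.quarterDatum Finset.univ := by
  classical
  -- passengers versus slots
  have hon : ∀ q : Psg, q.1 ≠ a' ∧ q.1 ≠ b' ∧ q.1 ≠ c' ∧ q.1 ≠ d' := by
    intro q
    have hq := q.2
    have hn : ¬ (q.1 = a ∨ q.1 = b ∨ q.1 = c ∨ q.1 = d) := by tauto
    rw [← hS4] at hn
    simp only [not_or] at hn
    exact hn
  have hoff : ∀ i, i ≠ a' → i ≠ b' → i ≠ c' → i ≠ d' → (i ≠ a ∧ i ≠ b ∧ i ≠ c ∧ i ≠ d) := by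
    intro i h₁ h₂ h₃ h₄
    have hn : ¬ (i = a' ∨ i = b' ∨ i = c' ∨ i = d') := by tauto
    rw [hS4] at hn
    simp only [not_or] at hn
    exact hn
  -- the slot renaming
  let slot : Fin 4 ⊕ Psg → Fin n := Sum.elim ![a', b', c', d'] Subtype.val
  have hslot_inj : Function.Injective slot :=
    slot_injective n a b c d a' b' c' d' hon h'ab h'ac h'ad h'bc h'bd h'cd
  -- the three injective maps and their composite `Φ : R₀ → k[x]`
  let S : Type := MvPolynomial (Fin n) k
  let D : ToricChart.ConeDatum 4 9 := Quarter1123.quarterDatum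
  let ρ : MvPolynomial (Fin 4 ⊕ Psg) k →ₐ[k] S := rename slot
  have hρinj : Function.Injective ρ := rename_injective slot hslot_inj
  let θ : S →ₐ[k] S := aeval g₅
  have hθinj : Function.Injective θ :=
    slotSubst5_injective k n a b c d e p hab hac had hae hbc hbd hbe hcd hce hde hp5
  let Φ : ToricChart.Ring k Psg D →ₐ[k] S :=
    θ.comp (ρ.comp (ToricChart.theta (k := k) (P := Psg) (D := D)))
  have hΦ : ∀ y, Φ y = θ (ρ (ToricChart.theta y)) := fun y => rfl
  have hΦinj : Function.Injective Φ :=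
    hθinj.comp (hρinj.comp ToricChart.theta_injective)
  -- `R = (ρ ∘ θ)(R₀)` is the weight-`0` part of `w'`
  let R : Subalgebra k S := (ρ.comp (ToricChart.theta (k := k) (P := Psg) (D := D))).range
  have hR : ∀ Q, Q ∈ R ↔ IsWeightedHomogeneous w' Q 0 := fun Q =>
    mem_range_rename_theta_iff k n a b c d a' b' c' d' hon h'ab h'ac h'ad h'bc h'bd h'cd hoff w' h0 h1
      h2 h3 hw'0 Q
  have hR₁ : ∀ Q, Q ∈ R ↔ IsWeightedHomogeneous w₁ Q 0 := fun Q => (hR Q).trans (hww Q).symm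
  -- res-type-036: the fixed ring of `σ_U` inside the weight-`0` part is `θ₅(R)`
  have hfix := chart0_fixedPoints_eq_map k n σU a b c d e hab hac had hae hbc hbd hbe hcd hce hde
    hUb hUc hUd hUe hσU p hp hp5 w₂ hw₂a hw₂b hw₂c hw₂d hw₂0 w₁ hw₁a hw₁b hw₁c hw₁d hw₁0 R hR₁
  have hΦmem : ∀ y, IsWeightedHomogeneous w₂ (Φ y) 0 ∧ σU (Φ y) = Φ y := by
    intro y
    have h : Φ y ∈ ((R.map θ : Subalgebra k S) : Set S) :=
      Subalgebra.mem_map.mpr ⟨_, ⟨y, rfl⟩, rfl⟩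
    rw [← hfix] at h
    exact h
  -- `ψC := eE⁻¹ ∘ Φ`
  let ψ' : ToricChart.Ring k Psg D →+* ↥E :=
    (Φ : ToricChart.Ring k Psg D →+* S).codRestrict E fun y => (hE _).mpr (hΦmem y).1
  have hψ'val : ∀ y, ((ψ' y : ↥E) : S) = Φ y := fun y => rfl
  let ψC : ToricChart.Ring k Psg D →+* C := (eE.symm : ↥E →+* C).comp ψ'
  have hψC : ∀ y, eE (ψC y) = ψ' y := fun y => eE.apply_symm_apply _
  -- the ratio values
  let q : Fin 40 → S := fun j =>
    X a ^ (4 * (exps12 j).1 + 3 * (exps12 j).2.1 + 2 * (exps12 j).2.2.1 + (exps12 j).2.2.2 - 12) *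
      X b ^ (exps12 j).2.1 * X c ^ (exps12 j).2.2.1 * X d ^ (exps12 j).2.2.2
  have hrootg : ∀ j, aeval r₅ (gens12 k n a b c d j) = X a ^ 12 * q j :=
    fun j => aeval_root5_gens12 k n a b c d hab hac had hbc hbd hcd j
  have hq0 : q 0 = 1 := by simp [q, exps12]
  have hq1 : q 1 = X b ^ 4 := by simp [q, exps12]
  have hq2 : q 2 = X c ^ 6 := by simp [q, exps12]
  have hq3 : q 3 = X d ^ 12 := by simp [q, exps12]
  have hval : ∀ (j : Fin 40) (tj : C), base (gens12 k n a b c d 0) * tj = base (gens12 k n a b c d j) →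
      ((eE tj : ↥E) : S) = q j := by
    intro j tj h
    have h1 := congrArg (fun z => ((eE z : ↥E) : S)) h
    simp only [map_mul, Subalgebra.coe_mul, hbase, hrootg, hq0, mul_one] at h1
    exact mul_left_cancel₀ (pow_ne_zero 12 (X_ne_zero a)) h1
  have hbXa : ((eE (base (X a)) : ↥E) : S) = X a ^ 4 := by rw [hbase]; exact root5_X_a k n a b c d
  have hbXb : ((eE (base (X b)) : ↥E) : S) = X a ^ 3 * X b := by
    rw [hbase]; exact root5_X_b k n a b c d hab
  have hbXc : ((eE (base (X c)) : ↥E) : S) = X a ^ 2 * X c := by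
    rw [hbase]; exact root5_X_c k n a b c d hac hbc
  have hbXd : ((eE (base (X d)) : ↥E) : S) = X a * X d := by
    rw [hbase]; exact root5_X_d k n a b c d had hbd hcd
  -- integrality and the prime variable ideals
  haveI : Algebra.IsIntegral (↥E) S := algebra_isIntegral_of_weight_four k n w₂ E hE
  have hinjE : Function.Injective (algebraMap (↥E) S) := fun x y h => Subtype.ext h
  -- THE RADICAL IDENTITY, uniform in the variable set `Z` (with `a, b ∈ Z`, `e ∉ Z`)
  have key : ∀ (Z : Set (Fin n)) (ZF : Finset (Fin 4)) (ι : Type) (tt : ι → C)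
      (hZa : a ∈ Z) (hab' : ∀ i ∈ Z, i = a ∨ i = b ∨ i = c ∨ i = d)
      (hpre : X '' (slot ⁻¹' Z) =
        (fun s : Fin 4 => (X (Sum.inl s) : MvPolynomial (Fin 4 ⊕ Psg) k)) '' (ZF : Set (Fin 4)))
      (hmix : ∀ j : Fin 9, ∃ i ∈ ZF, D.mx j i ≠ 0)
      (hθZ : (Ideal.span (X '' Z : Set S)).comap θ = Ideal.span (X '' Z))
      (htt : ∀ i, ((eE (tt i) : ↥E) : S) ∈ Ideal.span (X '' Z : Set S))
      (hgen : ∀ i ∈ Z, ∃ m, 0 < m ∧ (X i : S) ^ m ∈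
        (Ideal.span (eE '' (base '' {X a, X b, X c, X d} ∪ Set.range tt))).map (algebraMap (↥E) S)),
      ((Ideal.span (base '' {X a, X b, X c, X d} ∪ Set.range tt)).comap ψC).radical =
        ToricChart.faceIdeal k Psg D ZF := by
    intro Z ZF ι tt hZa hab' hpre hmix hθZ htt hgen
    haveI hM : (Ideal.span (X '' Z : Set S)).IsPrime := by
      rw [← SpanX.ker_aeval_kill_eq_span_X Z]; exact RingHom.ker_isPrime _
    have hXa : (X a : S) ∈ Ideal.span (X '' Z : Set S) := Ideal.subset_span ⟨a, hZa, rfl⟩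
    -- transport through `eE`
    have hstep1 : (Ideal.span (base '' {X a, X b, X c, X d} ∪ Set.range tt)).comap ψC =
        (Ideal.span (eE '' (base '' {X a, X b, X c, X d} ∪ Set.range tt))).comap ψ' := by
      change (Ideal.span _).comap ((eE.symm : ↥E →+* C).comp ψ') = _
      rw [← Ideal.comap_comap]
      congr 1
      change Ideal.comap eE.symm _ = _
      rw [Ideal.comap_symm, Ideal.map_span]
    -- the radical upstairs
    have hrad : (Ideal.span (eE '' (base '' {X a, X b, X c, X d} ∪ Set.range tt))).radical =
        (Ideal.span (X '' Z : Set S)).comap (algebraMap (↥E) S) := by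
      refine JordanFour.radical_span_eq_comap_of_isIntegral hinjE _ _ ?_ ?_
      · rintro _ ⟨x, hx, rfl⟩
        rcases hx with ⟨F, hF, rfl⟩ | ⟨i, rfl⟩
        · change ((eE (base F) : ↥E) : S) ∈ _
          simp only [Set.mem_insert_iff, Set.mem_singleton_iff] at hF
          rcases hF with rfl | rfl | rfl | rfl
          · rw [hbXa]
            exact Ideal.pow_mem_of_mem _ hXa _ (by norm_num)
          · rw [hbXb]
            exact Ideal.mul_mem_right _ _ (Ideal.pow_mem_of_mem _ hXa _ (by norm_num))
          · rw [hbXc]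
            exact Ideal.mul_mem_right _ _ (Ideal.pow_mem_of_mem _ hXa _ (by norm_num))
          · rw [hbXd]
            exact Ideal.mul_mem_right _ _ hXa
        · exact htt i
      · rw [Ideal.span_le]
        rintro _ ⟨i, hi, rfl⟩
        obtain ⟨m, -, hm⟩ := hgen i hi
        exact ⟨m, hm⟩
    rw [hstep1, ← Ideal.comap_radical, hrad, Ideal.comap_comap]
    have hcomp : (algebraMap (↥E) S).comp ψ' = (Φ : ToricChart.Ring k Psg D →+* S) :=
      RingHom.ext fun y => rfl
    rw [hcomp]
    change Ideal.comap (θ.comp (ρ.comp (ToricChart.theta (k := k) (P := Psg) (D := D)))) _ = _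
    rw [← Ideal.comap_comapₐ, ← Ideal.comap_comapₐ, hθZ]
    have hρZ : (Ideal.span (X '' Z : Set S)).comap ρ = Ideal.span (X '' (slot ⁻¹' Z)) :=
      SpanX.comap_rename_span_X slot hslot_inj Z
    rw [hρZ, hpre]
    exact ToricChart.comap_theta_span_X_eq_faceIdeal k Psg D ZF (by decide) hmix
  -- generic power witnesses `X i ^ m ∈ 𝔟 S`
  have hpow_base : ∀ (ι : Type) (tt : ι → C), (X a : S) ^ 4 ∈
      (Ideal.span (eE '' (base '' {X a, X b, X c, X d} ∪ Set.range tt))).map (algebraMap (↥E) S) := by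
    intro ι tt
    have h : eE (base (X a)) ∈ Ideal.span (eE '' (base '' {X a, X b, X c, X d} ∪ Set.range tt)) :=
      Ideal.subset_span ⟨_, Set.mem_union_left _ ⟨X a, by simp, rfl⟩, rfl⟩
    have h2 := Ideal.mem_map_of_mem (algebraMap (↥E) S) h
    have h3 : algebraMap (↥E) S (eE (base (X a))) = X a ^ 4 := hbXa
    rwa [h3] at h2
  have hpow_t : ∀ (ι : Type) (tt : ι → C) (i : ι), ((eE (tt i) : ↥E) : S) ∈
      (Ideal.span (eE '' (base '' {X a, X b, X c, X d} ∪ Set.range tt))).map (algebraMap (↥E) S) := by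
    intro ι tt i
    have h : eE (tt i) ∈ Ideal.span (eE '' (base '' {X a, X b, X c, X d} ∪ Set.range tt)) :=
      Ideal.subset_span ⟨_, Set.mem_union_right _ ⟨i, rfl⟩, rfl⟩
    exact Ideal.mem_map_of_mem (algebraMap (↥E) S) h
  -- preimages of the variable sets under the slot renaming
  have hpre3 := X_image_preimage_slot_three k n a b c d a' b' c' d' hon h'ac h'bc h'cd hS3
  have hpre4 := X_image_preimage_slot_univ k n a b c d a' b' c' d' hon hS4
  refine ⟨ψC, ?_, ?_, ?_, ?_⟩
  · -- injective
    intro x y hxy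
    have h1 : ψ' x = ψ' y := by rw [← hψC, ← hψC, hxy]
    have h2 := congrArg (fun z : ↥E => (z : S)) h1
    simp only [hψ'val] at h2
    exact hΦinj h2
  · -- range = fixed subring
    intro y
    constructor
    · rintro ⟨r, rfl⟩
      rw [hψC, hψ'val]
      exact (hΦmem r).2
    · intro hy
      have hmem : ((eE y : ↥E) : S) ∈ {f : S | IsWeightedHomogeneous w₂ f 0 ∧ σU f = f} :=
        ⟨(hE _).mp (eE y).2, hy⟩
      rw [hfix] at hmem
      obtain ⟨Q, hQ, hQy⟩ := Subalgebra.mem_map.mp hmem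
      obtain ⟨r, rfl⟩ := hQ
      refine ⟨r, ?_⟩
      apply eE.injective
      rw [hψC]
      exact Subtype.ext (by rw [hψ'val, hΦ]; exact hQy)
  · -- edge surface: `⟨x_a, x_b, x_d⟩` ↦ the axis face `{s, t, v}`
    refine key ({a, b, d} : Set (Fin n)) {0, 1, 3} _ t (by simp) ?_ hpre3 (by decide)
      (comap_slotSubst5_span_X_abd k n a b c d e p hab hac had hae hbc hbd hbe hcd hce hde hp hp5) ?_ ?_
    · intro i hi
      simp only [Set.mem_insert_iff, Set.mem_singleton_iff] at hi
      tauto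
    · intro j
      rw [hval j.1 (t j) (ht j)]
      exact rootRatio_mem_span_X_abd k n a b c d j.1 j.2
    · intro i hi
      simp only [Set.mem_insert_iff, Set.mem_singleton_iff] at hi
      rcases hi with rfl | rfl | rfl
      · exact ⟨4, by norm_num, hpow_base _ t⟩
      · refine ⟨4, by norm_num, ?_⟩
        have h := hpow_t _ t ⟨1, by decide⟩
        rwa [hval 1 _ (ht ⟨1, by decide⟩), hq1] at h
      · refine ⟨12, by norm_num, ?_⟩
        have h := hpow_t _ t ⟨3, by decide⟩
        rwa [hval 3 _ (ht ⟨3, by decide⟩), hq3] at h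
  · -- vertex curve: `⟨x_a, x_b, x_c, x_d⟩` ↦ the vertex face
    refine key ({a, b, c, d} : Set (Fin n)) Finset.univ _ t' (by simp) ?_ hpre4 (by decide)
      (comap_slotSubst5_span_X_abcd k n a b c d e p hab hac had hae hbc hbd hbe hcd hce hde hp hp5) ?_ ?_
    · intro i hi
      simp only [Set.mem_insert_iff, Set.mem_singleton_iff] at hi
      tauto
    · intro j
      rw [hval j.1 (t' j) (ht' j)]
      exact rootRatio_mem_span_X_abcd k n a b c d j.1 j.2
    · intro i hi
      simp only [Set.mem_insert_iff, Set.mem_singleton_iff] at hi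
      rcases hi with rfl | rfl | rfl | rfl
      · exact ⟨4, by norm_num, hpow_base _ t'⟩
      · refine ⟨4, by norm_num, ?_⟩
        have h := hpow_t _ t' ⟨1, by decide⟩
        rwa [hval 1 _ (ht' ⟨1, by decide⟩), hq1] at h
      · refine ⟨6, by norm_num, ?_⟩
        have h := hpow_t _ t' ⟨2, by decide⟩
        rwa [hval 2 _ (ht' ⟨2, by decide⟩), hq2] at h
      · refine ⟨12, by norm_num, ?_⟩
        have h := hpow_t _ t' ⟨3, by decide⟩
        rwa [hval 3 _ (ht' ⟨3, by decide⟩), hq3] at h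

include hab hac had hae hbc hbd hbe hcd hce hde in
-- one assembly over landed lemmas; the subalgebra coercions make some steps slow
set_option maxHeartbeats 800000 in
/-- **The chart-`0` (`μ₄`-vertex) ring model of the brick `HP₀`** (see the module docstring): an
injective `ψC : ToricChart.Ring k Psg quarterDatum → C` onto the `σ_U`-fixed subring with
`√(ψC⁻¹⟨base x_a,…,base x_d, t⟩) = faceIdeal {s,t,v}` (edge surface ↦ singular axis) and
`√(ψC⁻¹⟨base x_•, t'⟩) = faceIdeal univ` (vertex curve ↦ vertex); `p` prime, `5 ≤ p = char k`.
Slots `(a,b,c,d)` for `p ≡ 1 (mod 4)`, `(b,d,c,a)` for `p ≡ 3 (mod 4)`. [OURS · L1 W4.5c] -/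
theorem exists_ringBrick_X0_model (hp : p.Prime) (hp5 : 5 ≤ p) [CharP k p]
    (σU : MvPolynomial (Fin n) k ≃ₐ[k] MvPolynomial (Fin n) k)
    (hUb : σU (X b) = X b + X a) (hUc : σU (X c) = X c + X a * X b)
    (hUd : σU (X d) = X d + X a * X c) (hUe : σU (X e) = X e + X a * X d)
    (hσU : ∀ i, i ≠ b → i ≠ c → i ≠ d → i ≠ e → σU (X i) = X i)
    (w₂ : Fin n → ZMod 4) (hw₂a : w₂ a = 1) (hw₂b : w₂ b = 1) (hw₂c : w₂ c = 2) (hw₂d : w₂ d = 3)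
    (hw₂0 : ∀ i, i ≠ a → i ≠ b → i ≠ c → i ≠ d → w₂ i = 0)
    (E : Subalgebra k (MvPolynomial (Fin n) k)) (hE : ∀ f, f ∈ E ↔ IsWeightedHomogeneous w₂ f 0)
    {C : Type} [CommRing C] (base : MvPolynomial (Fin n) k →+* C) (eE : C ≃+* ↥E)
    (hbase : ∀ F, ((eE (base F) : ↥E) : MvPolynomial (Fin n) k) = aeval r₅ F)
    (t : {j : Fin 40 // j ≠ 0 ∧ j ≠ 2 ∧ j ≠ 5 ∧ j ≠ 13} → C)
    (ht : ∀ j, base (gens12 k n a b c d 0) * t j = base (gens12 k n a b c d j.1))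
    (t' : {j : Fin 40 // j ≠ 0} → C)
    (ht' : ∀ j, base (gens12 k n a b c d 0) * t' j = base (gens12 k n a b c d j.1)) :
    ∃ ψC : ToricChart.Ring k Psg Quarter1123.quarterDatum →+* C,
      Function.Injective ψC ∧
      (∀ y, y ∈ ψC.range ↔ σU ((eE y : ↥E) : MvPolynomial (Fin n) k) = (eE y : MvPolynomial (Fin n) k)) ∧
      ((Ideal.span (base '' {X a, X b, X c, X d} ∪ Set.range t)).comap ψC).radical =
        ToricChart.faceIdeal k Psg Quarter1123.quarterDatum {0, 1, 3} ∧
      ((Ideal.span (base '' {X a, X b, X c, X d} ∪ Set.range t')).comap ψC).radical =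
        ToricChart.faceIdeal k Psg Quarter1123.quarterDatum Finset.univ := by
  classical
  have hp4 : p % 4 = 1 ∨ p % 4 = 3 := by
    obtain ⟨m, hm⟩ := hp.odd_of_ne_two (by omega)
    omega
  -- res-type-036's weight `w₁ : (a,b,c,d) ↦ (1, p̄, 2, 3)`
  let w₁ : Fin n → ZMod 4 := fun i => if i = a then 1 else if i = b then (p : ZMod 4)
    else if i = c then 2 else if i = d then 3 else 0
  have hw₁a : w₁ a = 1 := by simp [w₁]
  have hw₁b : w₁ b = (p : ZMod 4) := by simp [w₁, hab.symm]
  have hw₁c : w₁ c = 2 := by simp [w₁, hac.symm, hbc.symm]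
  have hw₁d : w₁ d = 3 := by simp [w₁, had.symm, hbd.symm, hcd.symm]
  have hw₁0 : ∀ i, i ≠ a → i ≠ b → i ≠ c → i ≠ d → w₁ i = 0 := fun i h₁ h₂ h₃ h₄ => by
    simp [w₁, h₁, h₂, h₃, h₄]
  have hpcast : (p : ZMod 4) = ((p % 4 : ℕ) : ZMod 4) := (ZMod.natCast_mod p 4).symm
  rcases hp4 with h14 | h34
  · -- `p ≡ 1 (mod 4)`: slots `(a, b, c, d)`, `w' = w₁`
    have hb1 : w₁ b = 1 := by rw [hw₁b, hpcast, h14, Nat.cast_one]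
    exact exists_ringBrick_X0_model_of_slots k n a b c d e p hab hac had hae hbc hbd hbe hcd hce hde
      a b c d hab hac had hbc hbd hcd (fun i => Iff.rfl) (fun i => Iff.rfl) w₁ hw₁a hb1 hw₁c hw₁d hw₁0
      hp hp5 w₁ hw₁a hw₁b hw₁c hw₁d hw₁0 (fun Q => Iff.rfl) σU hUb hUc hUd hUe hσU w₂ hw₂a hw₂b hw₂c
      hw₂d hw₂0 E hE base eE hbase t ht t' ht'
  · -- `p ≡ 3 (mod 4)`: slots `(b, d, c, a)`, `w' = 3 • w₁` (`(1,3,2,3) = 3 • (3,1,2,1)`)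
    have hb3 : w₁ b = 3 := by rw [hw₁b, hpcast, h34, Nat.cast_ofNat]
    let w' : Fin n → ZMod 4 := fun i => 3 * w₁ i
    have h0 : w' b = 1 := by simp only [w', hb3]; decide
    have h1 : w' d = 1 := by simp only [w', hw₁d]; decide
    have h2 : w' c = 2 := by simp only [w', hw₁c]; decide
    have h3 : w' a = 3 := by simp only [w', hw₁a]; decide
    have hw'0 : ∀ i, i ≠ b → i ≠ d → i ≠ c → i ≠ a → w' i = 0 := fun i h₁ h₂ h₃ h₄ => by
      simp only [w', hw₁0 i h₄ h₁ h₃ h₂, mul_zero]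
    have hww : ∀ Q : MvPolynomial (Fin n) k,
        IsWeightedHomogeneous w₁ Q 0 ↔ IsWeightedHomogeneous w' Q 0 := fun Q =>
      (JordanFour.isWeightedHomogeneous_zero_iff_of_mul w₁ w' 3 3 (by decide) (fun i => rfl) Q).symm
    exact exists_ringBrick_X0_model_of_slots k n a b c d e p hab hac had hae hbc hbd hbe hcd hce hde
      b d c a hbd hbc (Ne.symm hab) hcd.symm (Ne.symm had) (Ne.symm hac) (fun i => by tauto)
      (fun i => by tauto) w' h0 h1 h2 h3 hw'0 hp hp5 w₁ hw₁a hw₁b hw₁c hw₁d hw₁0 hww σU hUb hUc hUd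
      hUe hσU w₂ hw₂a hw₂b hw₂c hw₂d hw₂0 E hE base eE hbase t ht t' ht'

end Summit.ResolutionOfSingularities.ResolutionOfSingularities.Theorems.WildQuotientResolution.JordanFive

end
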